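import Summits.MatrixMultiplication.MatrixMultiplication.Theses.ProbeRankScaling
import Summits.MatrixMultiplication.MatrixMultiplication.Theorems.ProbeRankThresholdFourthMomentPacking

/-!
# `FourthMomentPacking` for route ProbeRankScaling (item stmt-MatrixMultiplication-7541)

If a finite group `G` realizes `⟨n, m, p⟩` through the triple product property
(`Literature.Computability.AlgebraicComplexity.RealizesTPP G n m p`) and
`ℂ[G] ≃ₐ[ℂ] ∏ᵢ ℂ^{dᵢ×dᵢ}` (`Literature.RepresentationTheory.FiniteGroups.BlockAlgebraC d`), then
`n m p ≤ ∑ᵢ dᵢ⁴` (fourth-moment refinement of Cohn–Umans 2003, Lemma 3.1 / Neumann 2011, Obs. 4.1).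

This item is the verbatim twin of route ProbeRankThreshold's item stmt-MatrixMultiplication-7966,
whose statement inlines the two Literature definitions; it is closed by the tree theorem
`FourthMomentPackingProof.card_mul_card_mul_card_le`
(`Theorems/ProbeRankThresholdFourthMomentPacking.lean`: the identity matrix on `S × T × U`
factors through the index type `Σ i, (Fin dᵢ)⁴` by the X-rank flattening of the Cohn–Umans
embedding). Here we only unpack `RealizesTPP` and `BlockAlgebraC` (an `abbrev` of the block
product) and apply that theorem — one proof, one module, no restatement.
-/

namespace Summit.MatrixMultiplication.MatrixMultiplication.Theorems

/-- **`FourthMomentPacking`** (route ProbeRankScaling, item stmt-MatrixMultiplication-7541): if a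
finite group `G` realizes `⟨n, m, p⟩` (TPP) and `ℂ[G] ≃ₐ[ℂ] ∏ᵢ ℂ^{dᵢ×dᵢ}`, then
`n · m · p ≤ ∑ᵢ dᵢ⁴`. Unpacks `RealizesTPP` into a TPP triple `(S, T, U)` with
`|S| = n, |T| = m, |U| = p` and applies `FourthMomentPackingProof.card_mul_card_mul_card_le`. -/
theorem probeRankScaling_fourthMomentPacking_proof :
    Summit.MatrixMultiplication.MatrixMultiplication.Theses.ProbeRankScaling.FourthMomentPacking := by
  unfold Summit.MatrixMultiplication.MatrixMultiplication.Theses.ProbeRankScaling.FourthMomentPacking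
  intro G _ _ n m p hTPP r d hφ
  obtain ⟨S, T, U, rfl, rfl, rfl, tpp⟩ := hTPP
  obtain ⟨φ⟩ := hφ
  exact FourthMomentPackingProof.card_mul_card_mul_card_le φ S T U tpp

/-! ### Host-side corollary: packing against the largest character degree

The route records (not filed) the consequence "with `∑ dᵢ² = |G|`, useful irreps are large":
`n m p ≤ ∑ᵢ dᵢ⁴ ≤ d_max² ∑ᵢ dᵢ² = d_max² |G|`, an exponent-free companion of CKSU 2005, Cor. 1.9
(`(nmp)^{ω/3} ≤ d_max^{ω-2} |G|`); for abelian `G` (`d_max = 1`) it is Cohn–Umans 2003, Lemma 3.1. -/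

open Literature.Computability.AlgebraicComplexity Literature.RepresentationTheory.FiniteGroups

/-- Fourth-moment packing against the largest character degree, for a given block decomposition
`φ : ℂ[G] ≃ₐ ∏ᵢ ℂ^{dᵢ×dᵢ}` with all `dᵢ ≥ 1`: if `G` realizes `⟨n, m, p⟩` then
`n m p ≤ d_max(G)² · |G|` (`dᵢ ≤ d_max`, `blockDegree_le_maxCharDegree`; `∑ dᵢ² = |G|`,
`sum_sq_blockDegrees_eq_card`). -/
theorem mul_mul_le_maxCharDegree_sq_mul_card_of_algEquiv {G : Type} [Group G] [Finite G]
    {n m p : ℕ} (h : RealizesTPP G n m p) {r : ℕ} {d : Fin r → ℕ} [∀ i, NeZero (d i)]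
    (φ : MonoidAlgebra ℂ G ≃ₐ[ℂ] BlockAlgebraC d) :
    n * m * p ≤ maxCharDegree G ^ 2 * Nat.card G :=
  calc n * m * p ≤ ∑ i, d i ^ 4 := probeRankScaling_fourthMomentPacking_proof G n m p h r d ⟨φ⟩
    _ ≤ ∑ i, maxCharDegree G ^ 2 * d i ^ 2 := Finset.sum_le_sum fun i _ => by
        calc d i ^ 4 = d i ^ 2 * d i ^ 2 := by ring
          _ ≤ maxCharDegree G ^ 2 * d i ^ 2 :=
            Nat.mul_le_mul_right _ (Nat.pow_le_pow_left (blockDegree_le_maxCharDegree φ i) 2)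
    _ = maxCharDegree G ^ 2 * Nat.card G := by
        rw [← Finset.mul_sum, sum_sq_blockDegrees_eq_card φ]

/-- **Iso-free fourth-moment packing**: if a finite group `G` realizes `⟨n, m, p⟩` through the
triple product property, then `n m p ≤ d_max(G)² · |G|`, `d_max(G)` the largest complex
irreducible character degree (Wedderburn blocks from `exists_algEquiv_pi_matrix`). So a family of
TPP hosts with `n m p ≥ |G|^{1+2γ}` forces `d_max ≥ |G|^γ`. -/
theorem mul_mul_le_maxCharDegree_sq_mul_card {G : Type} [Group G] [Finite G] {n m p : ℕ}
    (h : RealizesTPP G n m p) : n * m * p ≤ maxCharDegree G ^ 2 * Nat.card G := by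
  obtain ⟨r, d, hd, ⟨φ⟩⟩ := exists_algEquiv_pi_matrix G
  exact mul_mul_le_maxCharDegree_sq_mul_card_of_algEquiv h φ

end Summit.MatrixMultiplication.MatrixMultiplication.Theorems
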